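import Literature.AlgebraicGeometry.ShimuraVarieties.UnitaryCurveConeHolomorphyOfCR
import Literature.Analysis.Complex.OsgoodProofs
import HarnessLib

/-!
# Regularity of cone-holomorphic cotangent-type functions (rank `2`): analyticity on the cone-open, smooth slices and smooth probes

Topic `AlgebraicGeometry/ShimuraVarieties`; namespace `Literature.AlgebraicGeometry.ShimuraVarieties.UnitaryCurveCone`.  THEOREMS ONLY (no `def`,
no instance, no notation, no named fact, no `sorry`); imports ★ `UnitaryCurveConeHolomorphyOfCR` (the rank-2 cone dictionary) and ★
`Analysis/Complex/OsgoodProofs` (Osgood: `ℂ`-differentiable on an open set of `ℂⁿ` ⇒ analytic ⇒ `C^∞`).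

For `Φ : M₂(ℂ) → ℂ` with ★ `IsConeHol 𝔣 Φ` (holomorphic on the cone-open `Ω = {g | IsUnit g ∧ g v₀ ∈ negCone}` of `ℂ^{2×2}`, with the cotangent law):
* `isOpen_coneOpen` — `Ω` is open (read on `Fin 2 → Fin 2 → ℂ`);
* `analyticOnNhd_of_isConeHol` ∕ `contDiffOn_of_isConeHol` ∕ `contDiffOn_real_of_isConeHol` — `Φ` is ANALYTIC, hence `C^∞` over `ℂ` and over `ℝ`, on `Ω`
  (★ `SCV.analyticOnNhd_of_differentiableOn`, ★ `SCV.contDiffOn_infty`);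
* `contDiffAt_of_isConeHol_of_mem` — `Φ` is `C^∞` at every point of `Ω`, in particular at every `u ∈ U = U(Jw)` (`contDiffAt_coe`);
* `continuous_slice_of_isConeHol` — the slice `u ↦ Φ u` on `U` is continuous (indeed smooth along the group);
* `contDiff_probe_of_isConeHol` — for `u ∈ U` and `X` valued in `𝔲(Jw)`, the `𝔭`-probe `z ↦ Φ (u · exp (X z))` is `C^∞` on all of `ℂ`, and
  `contDiffAt_probe_of_isConeHol_of_mem` — for `g ∈ Ω` it is `C^∞` at `z = 0`.
These are the regularity sockets of the rank-2 (S)∕(R) steps of a spectral-projection road («the slice of a holomorphic cotangent form is smooth on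
`U(σ_{w₁}J)(ℂ)`; its probes are smooth with derivatives continuous in the base point»): at rank 2 they are IMMEDIATE from holomorphy on the open
cone `Ω ⊃ U`, with no Lie-derivative estimates (contrast the rank-3 ★ `UnitaryBallLieDerivative` ∕ `F0P2dStubSOrbitMap`).  Borel (1997) §5.14 and
§2.13 (automorphic forms are analytic); Bergeron–Millson–Moeglin (2016) Part 2 §1.3.  Cell `hodgecm-mathlib`, floor 0, K-groundwork for the P5 named
fact TP₂; seat A-p14 (g16).  HC_CM is proved only modulo the printed citations until rung 0 closes; nothing printed is asserted here.

## References
* [Borel1997] A. Borel, *Automorphic forms on SL₂(ℝ)*, Cambridge Tracts in Math. 130 (1997), §2.13 and §5.14.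
* [BergeronMillsonMoeglin2016Balls] N. Bergeron, J. Millson, C. Moeglin, Acta Math. 216 (2016), Part 2 §1.3.
* [FritzscheGrauert2002] K. Fritzsche, H. Grauert, *From Holomorphic Functions to Complex Manifolds* (2002), Ch. I §6–§7 (Osgood, power series).
-/

set_option autoImplicit false

noncomputable section

open Matrix NumberField NumberField.InfinitePlace
open scoped Matrix ComplexConjugate ComplexOrder ContDiff
open Literature.NumberTheory.Automorphic Literature.NumberTheory.Automorphic.UnitaryGroup
open Literature.NumberTheory.Automorphic.UnitaryCurveForms
open Literature.Analysis.Complex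

namespace Literature.AlgebraicGeometry.ShimuraVarieties.UnitaryCurveCone

variable {E : Type} [Field E] {J : Matrix (Fin 2) (Fin 2) E} {w₁ : {w : InfinitePlace E // IsComplex w}}

section Regularity

open scoped Matrix.Norms.Operator
open _root_.Topology Filter

variable (𝔣 : ConeFrame E J w₁)

/-- **The cone-open is open** in `ℂ^{2×2}` (invertibility is `det ≠ 0`, negativity of `g v₀` is an open condition). [cite: BergeronMillsonMoeglin2016Balls, Part 2 §1.3] -/
theorem isOpen_coneOpen :
    IsOpen {m : Fin 2 → Fin 2 → ℂ | IsUnit (Matrix.of m) ∧ Matrix.of m *ᵥ 𝔣.v₀ ∈ negCone (J.map w₁.1.embedding)} := by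
  have hid : Continuous fun m : Fin 2 → Fin 2 → ℂ => Matrix.of m := continuous_id
  have h1 : IsOpen {m : Fin 2 → Fin 2 → ℂ | IsUnit (Matrix.of m)} := by
    have h : {m : Fin 2 → Fin 2 → ℂ | IsUnit (Matrix.of m)} = (fun m : Fin 2 → Fin 2 → ℂ => (Matrix.of m).det) ⁻¹' {0}ᶜ := by
      ext m
      simp only [Set.mem_setOf_eq, Set.mem_preimage, Set.mem_compl_iff, Set.mem_singleton_iff, Matrix.isUnit_iff_isUnit_det,
        isUnit_iff_ne_zero]
    rw [h]
    exact isOpen_compl_singleton.preimage hid.matrix_det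
  have h2 : IsOpen {m : Fin 2 → Fin 2 → ℂ | Matrix.of m *ᵥ 𝔣.v₀ ∈ negCone (J.map w₁.1.embedding)} :=
    (isOpen_negCone _).preimage (hid.matrix_mulVec continuous_const)
  exact h1.inter h2

variable {𝔣}

/-- **A cone-holomorphic function is ANALYTIC on the cone-open** (Osgood). [cite: FritzscheGrauert2002, Ch. I §6–§7] [cite: Borel1997, §2.13] -/
theorem analyticOnNhd_of_isConeHol {Φ : Matrix (Fin 2) (Fin 2) ℂ → ℂ} (hΦ : IsConeHol 𝔣 Φ) :
    AnalyticOnNhd ℂ (fun g : Fin 2 → Fin 2 → ℂ => Φ (Matrix.of g))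
      {m : Fin 2 → Fin 2 → ℂ | IsUnit (Matrix.of m) ∧ Matrix.of m *ᵥ 𝔣.v₀ ∈ negCone (J.map w₁.1.embedding)} :=
  SCV.analyticOnNhd_of_differentiableOn hΦ.1 (isOpen_coneOpen 𝔣)

/-- **A cone-holomorphic function is `C^∞` over `ℂ` on the cone-open.** [cite: FritzscheGrauert2002, Ch. I §6–§7] [cite: Borel1997, §2.13] -/
theorem contDiffOn_of_isConeHol {Φ : Matrix (Fin 2) (Fin 2) ℂ → ℂ} (hΦ : IsConeHol 𝔣 Φ) :
    ContDiffOn ℂ ∞ (fun g : Fin 2 → Fin 2 → ℂ => Φ (Matrix.of g))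
      {m : Fin 2 → Fin 2 → ℂ | IsUnit (Matrix.of m) ∧ Matrix.of m *ᵥ 𝔣.v₀ ∈ negCone (J.map w₁.1.embedding)} :=
  SCV.contDiffOn_infty hΦ.1 (isOpen_coneOpen 𝔣)

/-- **… and `C^∞` over `ℝ`** (restriction of scalars). [cite: Borel1997, §2.13] -/
theorem contDiffOn_real_of_isConeHol {Φ : Matrix (Fin 2) (Fin 2) ℂ → ℂ} (hΦ : IsConeHol 𝔣 Φ) :
    ContDiffOn ℝ ∞ (fun g : Fin 2 → Fin 2 → ℂ => Φ (Matrix.of g))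
      {m : Fin 2 → Fin 2 → ℂ | IsUnit (Matrix.of m) ∧ Matrix.of m *ᵥ 𝔣.v₀ ∈ negCone (J.map w₁.1.embedding)} :=
  (contDiffOn_of_isConeHol hΦ).restrict_scalars ℝ

/-- **`C^∞` at every point of the cone-open.** [cite: Borel1997, §2.13] -/
theorem contDiffAt_of_isConeHol_of_mem {Φ : Matrix (Fin 2) (Fin 2) ℂ → ℂ} (hΦ : IsConeHol 𝔣 Φ) {g : Matrix (Fin 2) (Fin 2) ℂ}
    (hg : IsUnit g) (hgv : g *ᵥ 𝔣.v₀ ∈ negCone (J.map w₁.1.embedding)) :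
    ContDiffAt ℂ ∞ (fun g : Fin 2 → Fin 2 → ℂ => Φ (Matrix.of g)) (Matrix.of.symm g) :=
  (contDiffOn_of_isConeHol hΦ).contDiffAt ((isOpen_coneOpen 𝔣).mem_nhds ⟨hg, hgv⟩)

/-- **`C^∞` at every `u ∈ U = U(Jw)`** (`U` lies in the cone-open). [cite: Borel1997, §2.13] -/
theorem contDiffAt_of_isConeHol_coe {Φ : Matrix (Fin 2) (Fin 2) ℂ → ℂ} (hΦ : IsConeHol 𝔣 Φ) (u : archLocal E 2 J w₁) :
    ContDiffAt ℂ ∞ (fun g : Fin 2 → Fin 2 → ℂ => Φ (Matrix.of g)) (Matrix.of.symm ((u : GL (Fin 2) ℂ) : Matrix (Fin 2) (Fin 2) ℂ)) :=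
  contDiffAt_of_isConeHol_of_mem hΦ (isUnit_and_mulVec_mem_negCone 𝔣 u).1 (isUnit_and_mulVec_mem_negCone 𝔣 u).2

/-- **The slice `u ↦ Φ u` on `U` is continuous** (indeed the restriction of a `C^∞` function along the continuous inclusion `U ↪ ℂ^{2×2}`).
[cite: Borel1997, §5.14] -/
theorem continuous_slice_of_isConeHol {Φ : Matrix (Fin 2) (Fin 2) ℂ → ℂ} (hΦ : IsConeHol 𝔣 Φ) :
    Continuous fun u : archLocal E 2 J w₁ => Φ ((u : GL (Fin 2) ℂ) : Matrix (Fin 2) (Fin 2) ℂ) := by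
  have hincl : Continuous fun u : archLocal E 2 J w₁ => ((u : GL (Fin 2) ℂ) : Matrix (Fin 2) (Fin 2) ℂ) :=
    Units.continuous_val.comp continuous_subtype_val
  have hincl' : Continuous fun u : archLocal E 2 J w₁ => Matrix.of.symm (((u : GL (Fin 2) ℂ) : Matrix (Fin 2) (Fin 2) ℂ)) :=
    hincl
  refine continuous_iff_continuousAt.2 fun u => ?_
  have h := (contDiffAt_of_isConeHol_coe hΦ u).continuousAt
  have h2 : ContinuousAt ((fun g : Fin 2 → Fin 2 → ℂ => Φ (Matrix.of g)) ∘
      fun u : archLocal E 2 J w₁ => Matrix.of.symm (((u : GL (Fin 2) ℂ) : Matrix (Fin 2) (Fin 2) ℂ))) u :=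
    ContinuousAt.comp h hincl'.continuousAt
  exact h2

/-- **The `𝔭`-probes through the group are `C^∞` on all of `ℂ`**: for `u ∈ U` and `X : ℂ →ₗ[ℝ] M₂(ℂ)` valued in `𝔲(Jw)`, the function
`z ↦ Φ (u · exp (X z))` is smooth (the curve `z ↦ u · exp (X z)` is smooth and stays in `U ⊆ Ω`). [cite: Borel1997, §5.14] [cite: Hall2015, Prop. 2.3–2.4] -/
theorem contDiff_probe_of_isConeHol {Φ : Matrix (Fin 2) (Fin 2) ℂ → ℂ} (hΦ : IsConeHol 𝔣 Φ) (hJ : (J.map w₁.1.embedding).IsHermitian)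
    (X : ℂ →ₗ[ℝ] Matrix (Fin 2) (Fin 2) ℂ) (hXu : ∀ z, (X z)ᴴ * J.map w₁.1.embedding + J.map w₁.1.embedding * X z = 0)
    (u : archLocal E 2 J w₁) :
    ContDiff ℝ ∞ fun z : ℂ => Φ (((u : GL (Fin 2) ℂ) : Matrix (Fin 2) (Fin 2) ℂ) * NormedSpace.exp (X z)) := by
  set uM : Matrix (Fin 2) (Fin 2) ℂ := ((u : GL (Fin 2) ℂ) : Matrix (Fin 2) (Fin 2) ℂ) with huM
  obtain ⟨γ, hγ⟩ := exists_expFamily_archLocal 𝔣 hJ X hXu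
  set XL : ℂ →L[ℝ] Matrix (Fin 2) (Fin 2) ℂ := LinearMap.toContinuousLinearMap X with hXLdef
  set idL : Matrix (Fin 2) (Fin 2) ℂ →L[ℝ] (Fin 2 → Fin 2 → ℂ) :=
    LinearMap.toContinuousLinearMap (Matrix.ofLinearEquiv ℝ).symm.toLinearMap with hidLdef
  have hexp : ContDiff ℝ ∞ (NormedSpace.exp : Matrix (Fin 2) (Fin 2) ℂ → Matrix (Fin 2) (Fin 2) ℂ) :=
    contDiff_iff_contDiffAt.2 fun A => (NormedSpace.exp_analytic (𝕂 := ℝ) A).contDiffAt.of_le le_top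
  have hcurve : ContDiff ℝ ∞ fun z : ℂ => idL (uM * NormedSpace.exp (XL z)) :=
    idL.contDiff.comp (contDiff_const.mul (hexp.comp XL.contDiff))
  rw [contDiff_iff_contDiffAt]
  intro z
  have hmem : ContDiffAt ℝ ∞ (fun g : Fin 2 → Fin 2 → ℂ => Φ (Matrix.of g)) (idL (uM * NormedSpace.exp (XL z))) := by
    have h := (contDiffAt_of_isConeHol_coe hΦ (u * γ z)).restrict_scalars ℝ
    have hpt : idL (uM * NormedSpace.exp (XL z)) =
        Matrix.of.symm (((u * γ z : archLocal E 2 J w₁) : GL (Fin 2) ℂ) : Matrix (Fin 2) (Fin 2) ℂ) := by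
      rw [Subgroup.coe_mul, Units.val_mul, hγ]; rfl
    rw [hpt]; exact h
  have key : ContDiffAt ℝ ∞ ((fun g : Fin 2 → Fin 2 → ℂ => Φ (Matrix.of g)) ∘ fun z : ℂ => idL (uM * NormedSpace.exp (XL z))) z :=
    hmem.comp z hcurve.contDiffAt
  have hfun : ((fun g : Fin 2 → Fin 2 → ℂ => Φ (Matrix.of g)) ∘ fun z : ℂ => idL (uM * NormedSpace.exp (XL z))) =
      fun z : ℂ => Φ (uM * NormedSpace.exp (X z)) := by
    funext z; rfl
  rw [hfun] at key
  exact key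

/-- **The `𝔭`-probe through a point of the cone-open is `C^∞` at `z = 0`** (the curve `z ↦ g · exp (X z)` starts at `g ∈ Ω`, open).
[cite: Borel1997, §5.14] -/
theorem contDiffAt_probe_of_isConeHol_of_mem {Φ : Matrix (Fin 2) (Fin 2) ℂ → ℂ} (hΦ : IsConeHol 𝔣 Φ) (X : ℂ →ₗ[ℝ] Matrix (Fin 2) (Fin 2) ℂ)
    {g : Matrix (Fin 2) (Fin 2) ℂ} (hg : IsUnit g) (hgv : g *ᵥ 𝔣.v₀ ∈ negCone (J.map w₁.1.embedding)) :
    ContDiffAt ℝ ∞ (fun z : ℂ => Φ (g * NormedSpace.exp (X z))) 0 := by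
  set XL : ℂ →L[ℝ] Matrix (Fin 2) (Fin 2) ℂ := LinearMap.toContinuousLinearMap X with hXLdef
  set idL : Matrix (Fin 2) (Fin 2) ℂ →L[ℝ] (Fin 2 → Fin 2 → ℂ) :=
    LinearMap.toContinuousLinearMap (Matrix.ofLinearEquiv ℝ).symm.toLinearMap with hidLdef
  have hexp : ContDiff ℝ ∞ (NormedSpace.exp : Matrix (Fin 2) (Fin 2) ℂ → Matrix (Fin 2) (Fin 2) ℂ) :=
    contDiff_iff_contDiffAt.2 fun A => (NormedSpace.exp_analytic (𝕂 := ℝ) A).contDiffAt.of_le le_top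
  have hcurve : ContDiff ℝ ∞ fun z : ℂ => idL (g * NormedSpace.exp (XL z)) :=
    idL.contDiff.comp (contDiff_const.mul (hexp.comp XL.contDiff))
  have hpt : idL (g * NormedSpace.exp (XL 0)) = Matrix.of.symm g := by
    rw [map_zero, NormedSpace.exp_zero, Matrix.mul_one]; rfl
  have hmem : ContDiffAt ℝ ∞ (fun g : Fin 2 → Fin 2 → ℂ => Φ (Matrix.of g)) (idL (g * NormedSpace.exp (XL 0))) := by
    rw [hpt]; exact (contDiffAt_of_isConeHol_of_mem hΦ hg hgv).restrict_scalars ℝ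
  have key : ContDiffAt ℝ ∞ ((fun g : Fin 2 → Fin 2 → ℂ => Φ (Matrix.of g)) ∘ fun z : ℂ => idL (g * NormedSpace.exp (XL z))) 0 :=
    hmem.comp (0 : ℂ) hcurve.contDiffAt
  have hfun : ((fun g : Fin 2 → Fin 2 → ℂ => Φ (Matrix.of g)) ∘ fun z : ℂ => idL (g * NormedSpace.exp (XL z))) =
      fun z : ℂ => Φ (g * NormedSpace.exp (X z)) := by
    funext z; rfl
  rw [hfun] at key
  exact key

/-- **Joint smoothness in the base point and the probe parameter**: `(g, z) ↦ Φ (g · exp (X z))` is `C^∞` on the open set where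
`g · exp (X z)` lies in the cone-open (in particular near `Ω × {0}` and on `(U-translates) × ℂ`). [cite: Borel1997, §2.13 and §5.14] -/
theorem contDiffOn_probe₂_of_isConeHol {Φ : Matrix (Fin 2) (Fin 2) ℂ → ℂ} (hΦ : IsConeHol 𝔣 Φ) (X : ℂ →ₗ[ℝ] Matrix (Fin 2) (Fin 2) ℂ) :
    ContDiffOn ℝ ∞ (fun p : (Fin 2 → Fin 2 → ℂ) × ℂ => Φ (Matrix.of p.1 * NormedSpace.exp (X p.2)))
      {p | IsUnit (Matrix.of p.1 * NormedSpace.exp (X p.2)) ∧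
        (Matrix.of p.1 * NormedSpace.exp (X p.2)) *ᵥ 𝔣.v₀ ∈ negCone (J.map w₁.1.embedding)} := by
  set XL : ℂ →L[ℝ] Matrix (Fin 2) (Fin 2) ℂ := LinearMap.toContinuousLinearMap X with hXLdef
  set idL : Matrix (Fin 2) (Fin 2) ℂ →L[ℝ] (Fin 2 → Fin 2 → ℂ) :=
    LinearMap.toContinuousLinearMap (Matrix.ofLinearEquiv ℝ).symm.toLinearMap with hidLdef
  set ofL : (Fin 2 → Fin 2 → ℂ) →L[ℝ] Matrix (Fin 2) (Fin 2) ℂ :=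
    LinearMap.toContinuousLinearMap (Matrix.ofLinearEquiv ℝ).toLinearMap with hofLdef
  have hexp : ContDiff ℝ ∞ (NormedSpace.exp : Matrix (Fin 2) (Fin 2) ℂ → Matrix (Fin 2) (Fin 2) ℂ) :=
    contDiff_iff_contDiffAt.2 fun A => (NormedSpace.exp_analytic (𝕂 := ℝ) A).contDiffAt.of_le le_top
  have hmap : ContDiff ℝ ∞ fun p : (Fin 2 → Fin 2 → ℂ) × ℂ => idL (ofL p.1 * NormedSpace.exp (XL p.2)) :=
    idL.contDiff.comp ((ofL.contDiff.comp contDiff_fst).mul (hexp.comp (XL.contDiff.comp contDiff_snd)))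
  have hmaps : Set.MapsTo (fun p : (Fin 2 → Fin 2 → ℂ) × ℂ => idL (ofL p.1 * NormedSpace.exp (XL p.2)))
      {p | IsUnit (Matrix.of p.1 * NormedSpace.exp (X p.2)) ∧
        (Matrix.of p.1 * NormedSpace.exp (X p.2)) *ᵥ 𝔣.v₀ ∈ negCone (J.map w₁.1.embedding)}
      {m : Fin 2 → Fin 2 → ℂ | IsUnit (Matrix.of m) ∧ Matrix.of m *ᵥ 𝔣.v₀ ∈ negCone (J.map w₁.1.embedding)} :=
    fun p hp => hp
  exact (contDiffOn_real_of_isConeHol hΦ).comp hmap.contDiffOn hmaps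

end Regularity

end Literature.AlgebraicGeometry.ShimuraVarieties.UnitaryCurveCone

end
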